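import Summits.AtomisticToContinuum.Crystallization.Theorems.ExcessDecayLiouvillePhononStabilityCertModelF
import Summits.AtomisticToContinuum.Crystallization.Theorems.ExcessDecayLiouvillePhononStabilityCertInterp

/-!
# Near-certificate layer V6-b: the cell theorem of the vertex scheme (lead c2)

Support file for crux `PhononStability` (stmt-AtomisticToContinuum-9333), line `contragredient-window-collapse`.

A rational cell of the chart (centre `cq`, half-widths `hq > 0`, variables `1 … 9`) on which the slice data of the
model form have good shape (`shapeOK9`, a cell-independent `Bool`) and positive `ρ`-intervals, and at whose `2⁹` vertices the model form dominates the cell defect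
`Σ_i M_i(w) h_i²/2` (the input supplied by the node checks, after the monotone comparison of layer V6-a), carries
`Fmodel ≥ 0` everywhere: `Fmodel_nonneg_on_cell` — the vertex interpolation lemma `ge_min_vertices_sub`
(`…CertInterp.lean`) applied to `x ↦ Fmodel(toN x)(w)` with the slice concavity `concaveOn_Fmodel`.
-/

noncomputable section

open scoped BigOperators
open Set Function
open Summit.AtomisticToContinuum.Crystallization.Theorems.PhononStabilityNegative

namespace Summit.AtomisticToContinuum.Crystallization.Theorems.PhononStabilityCWC.Cert

local notation "E3" => EuclideanSpace ℝ (Fin 3)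

/-! ## Chart points as assignments of the variables `1 … 9` -/

/-- the assignment `ℕ → ℝ` of a point `x : Fin 9 → ℝ` (variable `v ↦ x_{v−1}` for `1 ≤ v ≤ 9`, else `0`) -/
def toN (x : Fin 9 → ℝ) (v : ℕ) : ℝ := if h : 1 ≤ v ∧ v ≤ 9 then x ⟨v - 1, by omega⟩ else 0

/-- updating a coordinate commutes with `toN`. [folklore] -/
theorem toN_update (x : Fin 9 → ℝ) (i : Fin 9) (t : ℝ) : toN (update x i t) = update (toN x) (i.val + 1) t := by
  funext v
  rw [update_apply]
  by_cases hvi : v = i.val + 1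
  · rw [if_pos hvi]
    subst hvi
    unfold toN
    rw [dif_pos (by omega)]
    have : (⟨i.val + 1 - 1, by omega⟩ : Fin 9) = i := Fin.ext (by simp)
    rw [this, update_self]
  · rw [if_neg hvi]
    unfold toN
    split
    · rename_i hv
      rw [update_of_ne]
      intro h
      apply hvi
      have := congrArg Fin.val h
      simp only at this
      omega
    · rfl

/-- the box of variable intervals of a rational cell -/
def cellBox (cq hq : Fin 9 → ℚ) : Box := fun v =>
  if h : 1 ≤ v ∧ v ≤ 9 then ⟨cq ⟨v - 1, by omega⟩ - hq ⟨v - 1, by omega⟩, cq ⟨v - 1, by omega⟩ + hq ⟨v - 1, by omega⟩⟩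
  else ⟨0, 0⟩

/-- a point of the real cell is in the cell box. [folklore] -/
theorem mem_cellBox {cq hq : Fin 9 → ℚ} {x : Fin 9 → ℝ} (hx : x ∈ box (fun i => (cq i : ℝ)) (fun i => (hq i : ℝ)))
    : (cellBox cq hq).mem (toN x) := by
  intro v
  unfold cellBox toN
  by_cases hv : 1 ≤ v ∧ v ≤ 9
  · rw [dif_pos hv, dif_pos hv]
    have := hx ⟨v - 1, by omega⟩
    exact ⟨by push_cast; exact this.1, by push_cast; exact this.2⟩
  · rw [dif_neg hv, dif_neg hv]
    exact ⟨by simp, by simp⟩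

/-- the vertex of sign pattern `σ` -/
def vertexPt (cq hq : Fin 9 → ℚ) (σ : Fin 9 → Bool) (i : Fin 9) : ℚ := if σ i then cq i + hq i else cq i - hq i

/-- a vertex of the real cell is the cast of a rational vertex. [folklore] -/
theorem isVertex_eq_vertexPt {cq hq : Fin 9 → ℚ} {x : Fin 9 → ℝ}
    (hx : IsVertex (fun i => (cq i : ℝ)) (fun i => (hq i : ℝ)) x) :
    ∃ σ : Fin 9 → Bool, x = fun i => (vertexPt cq hq σ i : ℝ) := by
  refine ⟨fun i => decide (x i = cq i + hq i), funext fun i => ?_⟩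
  dsimp only [vertexPt]
  simp only [decide_eq_true_eq]
  by_cases hd : x i = (cq i : ℝ) + hq i
  · rw [if_pos hd]; push_cast; exact hd
  · rw [if_neg hd]
    push_cast
    rcases hx i with h | h
    · exact h
    · exact absurd h hd

/-! ## The cell check and the cell theorem -/

/-- the (cell-independent) shape check for all nine variables -/
def shapeOK9 (CL : List ClassDat) (Aff Cq : List (BondClass × List (Mono × Mat))) : Bool :=
  decide (∀ i : Fin 9, sliceShapeOK CL Aff Cq (i.val + 1) = true)

/-- the cell defect `Σ_i M_i(w) h_i²/2` -/
def cellDefect (CL : List ClassDat) (cq hq : Fin 9 → ℚ) (w : Label → E3) : ℝ :=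
  ∑ i : Fin 9, curvM CL (cellBox cq hq) (i.val + 1) w * (hq i : ℝ) ^ 2 / 2

/-- **THE CELL THEOREM OF THE VERTEX SCHEME.** If the cell data are good and the model form dominates the cell defect
at the `2⁹` vertices, the model form is nonnegative on the whole cell. [folklore] -/
theorem Fmodel_nonneg_on_cell {w : Label → E3} (hw : (support w).Finite) {CL : List ClassDat}
    {Aff Cq : List (BondClass × List (Mono × Mat))} {cq hq : Fin 9 → ℚ} (hh : ∀ i, 0 < hq i)
    (hshape : shapeOK9 CL Aff Cq = true) (hpos : ∀ e ∈ CL, 0 < (rhoIvl e.ρbar e.P (cellBox cq hq)).lo)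
    (hvert : ∀ σ : Fin 9 → Bool, cellDefect CL cq hq w ≤ Fmodel CL Aff Cq (toN fun i => (vertexPt cq hq σ i : ℝ)) w)
    {x : Fin 9 → ℝ} (hx : x ∈ box (fun i => (cq i : ℝ)) (fun i => (hq i : ℝ))) : 0 ≤ Fmodel CL Aff Cq (toN x) w := by
  unfold shapeOK9 at hshape
  simp only [decide_eq_true_eq] at hshape
  have hsl := hshape
  have hh' : ∀ i, (0 : ℝ) < (hq i : ℝ) := fun i => by exact_mod_cast hh i
  have key := ge_min_vertices_sub (c := fun i => (cq i : ℝ)) (h := fun i => (hq i : ℝ))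
    (M := fun i => curvM CL (cellBox cq hq) (i.val + 1) w) (f := fun x => Fmodel CL Aff Cq (toN x) w) hh'
    (fun i => curvM_nonneg CL _ _ w) ?_ (m := cellDefect CL cq hq w) ?_ hx
  · have : cellDefect CL cq hq w - ∑ i : Fin 9, curvM CL (cellBox cq hq) (i.val + 1) w * (hq i : ℝ) ^ 2 / 2 = 0 := by
      unfold cellDefect; ring
    linarith
  · intro y hy i
    have hB := mem_cellBox hy
    have hc := concaveOn_Fmodel hw (hsl i) hpos hB
    have hlo : (((cellBox cq hq) (i.val + 1)).lo : ℝ) = (cq i : ℝ) - hq i := by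
      unfold cellBox
      have hv : 1 ≤ i.val + 1 ∧ i.val + 1 ≤ 9 := by omega
      rw [dif_pos hv]
      have : (⟨i.val + 1 - 1, by omega⟩ : Fin 9) = i := by ext; simp
      simp only [this]; push_cast; ring
    have hhi : (((cellBox cq hq) (i.val + 1)).hi : ℝ) = (cq i : ℝ) + hq i := by
      unfold cellBox
      have hv : 1 ≤ i.val + 1 ∧ i.val + 1 ≤ 9 := by omega
      rw [dif_pos hv]
      have : (⟨i.val + 1 - 1, by omega⟩ : Fin 9) = i := by ext; simp
      simp only [this]; push_cast; ring
    rw [hlo, hhi] at hc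
    have hfun : (fun t => Fmodel CL Aff Cq (toN (update y i t)) w - curvM CL (cellBox cq hq) (i.val + 1) w / 2 * t ^ 2)
        = fun t => Fmodel CL Aff Cq (update (toN y) (i.val + 1) t) w - curvM CL (cellBox cq hq) (i.val + 1) w / 2 * t ^ 2 := by
      funext t; rw [toN_update]
    show ConcaveOn ℝ (Icc ((cq i : ℝ) - hq i) ((cq i : ℝ) + hq i))
      (fun t => Fmodel CL Aff Cq (toN (update y i t)) w - curvM CL (cellBox cq hq) (i.val + 1) w / 2 * t ^ 2)
    rw [hfun]
    exact hc
  · intro y hy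
    obtain ⟨σ, rfl⟩ := isVertex_eq_vertexPt hy
    exact hvert σ

/-- Anchor of this support file (registered stub of the line skeleton, lead c2): `toN` of the origin. -/
theorem stub_certCell : toN 0 5 = 0 := by
  simp [toN]

end Summit.AtomisticToContinuum.Crystallization.Theorems.PhononStabilityCWC.Cert

end
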